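import Summits.QuantumFields.GaugeBoot.TorusPeeling
import HarnessLib

/-!
# Gauge-boot: a Laplace upper bound from a small-ball upper bound —
# `κ{c ≤ t} ≤ A t^k ⟹ ∫ e^{−βc} dκ ≤ A · C_k · β^{−k}` (supplement 21, part 3f, file 1/2)

HONEST FRAMING (cell `pub-gaugeboot`, page 1 of every file): certified bounds on lattice
expectations at STATED coupling, gauge group, dimension and torus size; NOT a mass gap, NOT a
continuum limit, NOT a string tension, NOT large `N`; NOT Yang–Mills-summit-bearing (barriers
`FixedCouplingUltralocality`, `PerturbativeInvisibility`).  Pure measure theory; it certifies no number.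

## Content

For a probability measure `κ`, a measurable cost `0 ≤ c ≤ M` and a power-law small-ball UPPER bound
`κ{c ≤ t} ≤ A t^k` (`t > 0`, `k > 0`, `A ≥ 0`):

* `Laplace.rpow_mul_exp_neg_half_le` — `x^k e^{−x/2} ≤ (2k/e)^k` for `x > 0` (`log y ≤ y − 1`);
* ★★ `Laplace.integral_exp_neg_mul_le` — **`∫ e^{−βc} dκ ≤ A · C_k · β^{−k}`** for `β > 0`, with
  `C_k = laplaceConst k = e^{1/2} (2k/e)^k / (1 − e^{−1/2})`: bound `e^{−βc}` by the finite sum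
  `Σ_{j ≤ ⌊βM⌋} e^{−j} 1{c ≤ (j+1)/β}`, integrate, use the small-ball bound and `(j+1)^k e^{−j} ≤
  e^{1/2}(2k/e)^k e^{−j/2}`, and sum the geometric series — no layer-cake formula, no Gamma function;
* ★★ `Laplace.log_integral_exp_neg_mul_le` — the logarithmic form
  `log ∫ e^{−βc} dκ ≤ (log A + log C_k) − k log β` consumed by part 3e (`DeficitRate`, hypothesis `hz`).

[folklore] (Laplace's method with a volume-growth hypothesis.)
-/

noncomputable section

open MeasureTheory Filter Finset

namespace Summit.QuantumFields.GaugeBoot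

namespace Laplace

/-- The constant `C_k = e^{1/2} (2k/e)^k / (1 − e^{−1/2})` of the Laplace bound. -/
def laplaceConst (k : ℝ) : ℝ := Real.exp (1 / 2) * (2 * k / Real.exp 1) ^ k / (1 - Real.exp (-(1 / 2)))

/-- `1 − e^{−1/2} > 0`. -/
theorem one_sub_exp_neg_half_pos : 0 < 1 - Real.exp (-(1 / 2 : ℝ)) := by
  have : Real.exp (-(1 / 2 : ℝ)) < 1 := Real.exp_lt_one_iff.2 (by norm_num)
  linarith

/-- `C_k > 0` for `k > 0`. -/
theorem laplaceConst_pos {k : ℝ} (hk : 0 < k) : 0 < laplaceConst k := by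
  unfold laplaceConst
  have h1 : 0 < (2 * k / Real.exp 1) ^ k := Real.rpow_pos_of_pos (by positivity) k
  have h2 := one_sub_exp_neg_half_pos
  positivity

/-- `x^k e^{−x/2} ≤ (2k/e)^k` for `x > 0`, `k > 0` (from `log (x/(2k)) ≤ x/(2k) − 1`). [folklore] -/
theorem rpow_mul_exp_neg_half_le {x k : ℝ} (hx : 0 < x) (hk : 0 < k) :
    x ^ k * Real.exp (-(x / 2)) ≤ (2 * k / Real.exp 1) ^ k := by
  have h2k : 0 < 2 * k := by linarith
  have hlog := Real.log_le_sub_one_of_pos (div_pos hx h2k)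
  rw [Real.log_div hx.ne' h2k.ne'] at hlog
  -- `k log x − x/2 ≤ k log (2k) − k`
  have hkey : k * Real.log x - x / 2 ≤ k * Real.log (2 * k) - k := by
    have := mul_le_mul_of_nonneg_left hlog hk.le
    have hx2k : k * (x / (2 * k) - 1) = x / 2 - k := by field_simp
    rw [hx2k, mul_sub] at this
    linarith
  rw [Real.rpow_def_of_pos hx, Real.div_rpow (by positivity) (Real.exp_pos 1).le, Real.rpow_def_of_pos h2k,
    ← Real.exp_add, le_div_iff₀ (Real.rpow_pos_of_pos (Real.exp_pos 1) k), Real.rpow_def_of_pos (Real.exp_pos 1),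
    Real.log_exp, one_mul, ← Real.exp_add, Real.exp_le_exp]
  linarith

/-- `(j+1)^k e^{−j} ≤ e^{1/2} (2k/e)^k e^{−j/2}`. [folklore] -/
theorem succ_rpow_mul_exp_neg_le (j : ℕ) {k : ℝ} (hk : 0 < k) :
    ((j : ℝ) + 1) ^ k * Real.exp (-(j : ℝ)) ≤
      Real.exp (1 / 2) * (2 * k / Real.exp 1) ^ k * Real.exp (-((j : ℝ) / 2)) := by
  have h := rpow_mul_exp_neg_half_le (x := (j : ℝ) + 1) (by positivity) hk
  have hsplit : Real.exp (-(j : ℝ)) = Real.exp (-(((j : ℝ) + 1) / 2)) * (Real.exp (1 / 2) * Real.exp (-((j : ℝ) / 2))) := by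
    rw [← Real.exp_add, ← Real.exp_add]; congr 1; ring
  rw [hsplit, ← mul_assoc]
  calc ((j : ℝ) + 1) ^ k * Real.exp (-(((j : ℝ) + 1) / 2)) * (Real.exp (1 / 2) * Real.exp (-((j : ℝ) / 2)))
      ≤ (2 * k / Real.exp 1) ^ k * (Real.exp (1 / 2) * Real.exp (-((j : ℝ) / 2))) :=
        mul_le_mul_of_nonneg_right h (by positivity)
    _ = _ := by ring

/-- The finite geometric sum `Σ_{j<n} e^{−j/2} ≤ 1/(1 − e^{−1/2})`. [folklore] -/
theorem sum_exp_neg_half_le (n : ℕ) :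
    ∑ j ∈ Finset.range n, Real.exp (-((j : ℝ) / 2)) ≤ 1 / (1 - Real.exp (-(1 / 2))) := by
  have hr0 : 0 ≤ Real.exp (-(1 / 2 : ℝ)) := (Real.exp_pos _).le
  have hr1 : Real.exp (-(1 / 2 : ℝ)) < 1 := Real.exp_lt_one_iff.2 (by norm_num)
  have hgeom : ∀ j : ℕ, Real.exp (-((j : ℝ) / 2)) = Real.exp (-(1 / 2 : ℝ)) ^ j := fun j => by
    rw [← Real.exp_nat_mul]; congr 1; ring
  simp_rw [hgeom]
  calc ∑ j ∈ Finset.range n, Real.exp (-(1 / 2 : ℝ)) ^ j ≤ ∑' j : ℕ, Real.exp (-(1 / 2 : ℝ)) ^ j :=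
        (summable_geometric_of_lt_one hr0 hr1).sum_le_tsum _ (fun j _ => pow_nonneg hr0 j)
    _ = 1 / (1 - Real.exp (-(1 / 2))) := by rw [tsum_geometric_of_lt_one hr0 hr1, inv_eq_one_div]

variable {X : Type*} [MeasurableSpace X] (κ : Measure X) [IsProbabilityMeasure κ]

omit [MeasurableSpace X] in
/-- **Shell bound**: `e^{−βc(x)} ≤ Σ_{j ≤ ⌊βM⌋} e^{−j} 1{c(x) ≤ (j+1)/β}` for `0 ≤ c(x) ≤ M`, `β > 0`. [folklore] -/
theorem exp_neg_mul_le_sum {c : X → ℝ} (hc0 : ∀ x, 0 ≤ c x) {M : ℝ} (hcM : ∀ x, c x ≤ M) {β : ℝ} (hβ : 0 < β)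
    (x : X) :
    Real.exp (-β * c x) ≤ ∑ j ∈ Finset.range (⌊β * M⌋₊ + 1),
      Real.exp (-(j : ℝ)) * Set.indicator {y : X | c y ≤ ((j : ℝ) + 1) / β} (fun _ => (1 : ℝ)) x := by
  set j₀ : ℕ := ⌊β * c x⌋₊ with hj₀
  have hβc : 0 ≤ β * c x := mul_nonneg hβ.le (hc0 x)
  have hj₀mem : j₀ ∈ Finset.range (⌊β * M⌋₊ + 1) := by
    rw [Finset.mem_range, Nat.lt_succ_iff, hj₀]
    exact Nat.floor_mono (mul_le_mul_of_nonneg_left (hcM x) hβ.le)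
  have hxmem : x ∈ {y : X | c y ≤ ((j₀ : ℝ) + 1) / β} := by
    rw [Set.mem_setOf_eq, le_div_iff₀ hβ, mul_comm]
    exact (Nat.lt_floor_add_one (β * c x)).le
  have hterm : Real.exp (-β * c x) ≤ Real.exp (-(j₀ : ℝ)) * Set.indicator {y : X | c y ≤ ((j₀ : ℝ) + 1) / β} (fun _ => (1 : ℝ)) x := by
    rw [Set.indicator_of_mem hxmem, mul_one, Real.exp_le_exp, neg_mul, neg_le_neg_iff]
    exact Nat.floor_le hβc
  refine hterm.trans (Finset.single_le_sum (f := fun j : ℕ => Real.exp (-(j : ℝ)) *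
    Set.indicator {y : X | c y ≤ ((j : ℝ) + 1) / β} (fun _ => (1 : ℝ)) x) (fun j _ => ?_) hj₀mem)
  exact mul_nonneg (Real.exp_pos _).le (Set.indicator_nonneg (fun _ _ => zero_le_one) _)

/-- ★★ **Laplace bound from a small-ball upper bound**: `κ` a probability measure, `c` measurable with
`0 ≤ c ≤ M`, `κ{c ≤ t} ≤ A t^k` for `t > 0` (`A ≥ 0`, `k > 0`); then for every `β > 0`,
`∫ e^{−βc} dκ ≤ A · C_k · β^{−k}`. [folklore] -/
theorem integral_exp_neg_mul_le {c : X → ℝ} (hc : Measurable c) (hc0 : ∀ x, 0 ≤ c x) {M : ℝ} (hcM : ∀ x, c x ≤ M)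
    {A k : ℝ} (hA : 0 ≤ A) (hk : 0 < k) (hball : ∀ t : ℝ, 0 < t → κ.real {x | c x ≤ t} ≤ A * t ^ k)
    {β : ℝ} (hβ : 0 < β) :
    ∫ x, Real.exp (-β * c x) ∂κ ≤ A * laplaceConst k * β ^ (-k) := by
  set n : ℕ := ⌊β * M⌋₊ + 1
  set S : ℕ → Set X := fun j => {y : X | c y ≤ ((j : ℝ) + 1) / β} with hS
  have hSm : ∀ j, MeasurableSet (S j) := fun j => measurableSet_le hc measurable_const
  -- integrate the shell bound
  have hint : ∫ x, Real.exp (-β * c x) ∂κ ≤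
      ∑ j ∈ Finset.range n, Real.exp (-(j : ℝ)) * κ.real (S j) := by
    have h1 : ∫ x, Real.exp (-β * c x) ∂κ ≤
        ∫ x, ∑ j ∈ Finset.range n, Real.exp (-(j : ℝ)) * (S j).indicator (fun _ => (1 : ℝ)) x ∂κ := by
      refine integral_mono_of_nonneg (ae_of_all _ fun x => (Real.exp_pos _).le) ?_
        (ae_of_all _ fun x => exp_neg_mul_le_sum hc0 hcM hβ x)
      exact integrable_finsetSum _ fun j _ =>
        (((integrable_const (μ := κ) (1 : ℝ)).indicator (hSm j)).const_mul _)
    refine h1.trans (le_of_eq ?_)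
    rw [integral_finsetSum _ fun j _ => (((integrable_const (μ := κ) (1 : ℝ)).indicator (hSm j)).const_mul _)]
    refine Finset.sum_congr rfl fun j _ => ?_
    rw [integral_const_mul, integral_indicator_const _ (hSm j), smul_eq_mul, mul_one]
  -- use the small-ball bound shell by shell
  have hshell : ∀ j ∈ Finset.range n, Real.exp (-(j : ℝ)) * κ.real (S j) ≤
      A * β ^ (-k) * (Real.exp (1 / 2) * (2 * k / Real.exp 1) ^ k) * Real.exp (-((j : ℝ) / 2)) := by
    intro j _
    have ht : 0 < ((j : ℝ) + 1) / β := by positivity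
    have h1 := hball _ ht
    have h2 : (((j : ℝ) + 1) / β) ^ k = ((j : ℝ) + 1) ^ k * β ^ (-k) := by
      rw [Real.div_rpow (by positivity) hβ.le, Real.rpow_neg hβ.le, div_eq_mul_inv]
    have h3 := succ_rpow_mul_exp_neg_le j hk
    calc Real.exp (-(j : ℝ)) * κ.real (S j) ≤ Real.exp (-(j : ℝ)) * (A * (((j : ℝ) + 1) / β) ^ k) :=
          mul_le_mul_of_nonneg_left h1 (Real.exp_pos _).le
      _ = A * β ^ (-k) * (((j : ℝ) + 1) ^ k * Real.exp (-(j : ℝ))) := by rw [h2]; ring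
      _ ≤ A * β ^ (-k) * (Real.exp (1 / 2) * (2 * k / Real.exp 1) ^ k * Real.exp (-((j : ℝ) / 2))) :=
          mul_le_mul_of_nonneg_left h3 (by positivity)
      _ = _ := by ring
  have hsum := Finset.sum_le_sum hshell
  rw [← Finset.mul_sum] at hsum
  have hgeo := sum_exp_neg_half_le n
  have hpos : 0 ≤ A * β ^ (-k) * (Real.exp (1 / 2) * (2 * k / Real.exp 1) ^ k) := by
    have : 0 ≤ (2 * k / Real.exp 1) ^ k := (Real.rpow_pos_of_pos (by positivity) k).le
    positivity
  calc ∫ x, Real.exp (-β * c x) ∂κ ≤ ∑ j ∈ Finset.range n, Real.exp (-(j : ℝ)) * κ.real (S j) := hint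
    _ ≤ A * β ^ (-k) * (Real.exp (1 / 2) * (2 * k / Real.exp 1) ^ k) * ∑ j ∈ Finset.range n, Real.exp (-((j : ℝ) / 2)) := hsum
    _ ≤ A * β ^ (-k) * (Real.exp (1 / 2) * (2 * k / Real.exp 1) ^ k) * (1 / (1 - Real.exp (-(1 / 2)))) :=
        mul_le_mul_of_nonneg_left hgeo hpos
    _ = A * laplaceConst k * β ^ (-k) := by unfold laplaceConst; ring

/-- ★★ **Logarithmic form**: under the same hypotheses with `A > 0`,
`log ∫ e^{−βc} dκ ≤ (log A + log C_k) − k log β`. [folklore] -/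
theorem log_integral_exp_neg_mul_le {c : X → ℝ} (hc : Measurable c) (hc0 : ∀ x, 0 ≤ c x) {M : ℝ}
    (hcM : ∀ x, c x ≤ M) {A k : ℝ} (hA : 0 < A) (hk : 0 < k)
    (hball : ∀ t : ℝ, 0 < t → κ.real {x | c x ≤ t} ≤ A * t ^ k) {β : ℝ} (hβ : 0 < β) :
    Real.log (∫ x, Real.exp (-β * c x) ∂κ) ≤ (Real.log A + Real.log (laplaceConst k)) - k * Real.log β := by
  have h := integral_exp_neg_mul_le κ hc hc0 hcM hA.le hk hball hβ
  have hint_pos : 0 < ∫ x, Real.exp (-β * c x) ∂κ := by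
    have hlow : ∀ x, Real.exp (-β * M) ≤ Real.exp (-β * c x) := fun x => by
      rw [Real.exp_le_exp]; nlinarith [hcM x]
    calc (0 : ℝ) < Real.exp (-β * M) := Real.exp_pos _
      _ = ∫ _x, Real.exp (-β * M) ∂κ := by simp
      _ ≤ ∫ x, Real.exp (-β * c x) ∂κ := integral_mono (integrable_const _)
          (Integrable.of_bound ((Real.measurable_exp.comp (hc.const_mul _)).aestronglyMeasurable) 1
            (ae_of_all _ fun x => by
              rw [Real.norm_eq_abs, abs_of_nonneg (Real.exp_pos _).le, Real.exp_le_one_iff]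
              nlinarith [hc0 x])) hlow
  calc Real.log (∫ x, Real.exp (-β * c x) ∂κ) ≤ Real.log (A * laplaceConst k * β ^ (-k)) :=
        Real.log_le_log hint_pos h
    _ = (Real.log A + Real.log (laplaceConst k)) - k * Real.log β := by
        rw [Real.log_mul (mul_pos hA (laplaceConst_pos hk)).ne' (Real.rpow_pos_of_pos hβ _).ne',
          Real.log_mul hA.ne' (laplaceConst_pos hk).ne', Real.log_rpow hβ]
        ring

end Laplace

end Summit.QuantumFields.GaugeBoot

end
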